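import Summits.Langlands.Langlands.Theorems.PicardMuOrdinaryMuOrdinaryFamilyRTThorneAdequacyResidual
import Literature.NumberTheory.GaloisRepresentations.ResidualRepTwist
import Literature.NumberTheory.GaloisRepresentations.AbsIrreducibleIndexTwo
import Literature.NumberTheory.GaloisRepresentations.TwistedSumFiniteOrderGeneric
import Literature.NumberTheory.GaloisRepresentations.CalegariEvenFontaineMazurTwo
import HarnessLib

/-!
# Crux `MuOrdinaryFamilyRT` (stmt-Langlands-13757), line `thorne-minimal-lift`:
# PA-I glue H6' = G10' — hypothesis (ii) of Thorne's Thm 5.1 and irreducibility for the TWISTED point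
# representation over `L`, tower form (PROVED)

Glue `residual_adequate_twist_pointRep_tower` (registered) for `stub_thorneInputOverL`.  Thorne's
minimal automorphy lifting theorem (`Thorne2017.automorphyLifting_unitary_ordinaryMinimal`) is applied
over a soluble CM extension `L ⊇ F' ⊇ K = ℚ(ζ₃)` to `ρ = ((ρ_y|Γ_{F'}) ⊗ θ)|Γ_L`, where `ρ_y = y ∘ 𝓕.ρ`
is the point representation (`pointRep 𝓕 y`) of a family `𝓕 : OrdFamily f ι e S₀ ρ_C` at an INTEGRAL
`ℚ̄₃`-point `y` (`‖y r‖ ≤ 1`), and `θ : Γ_{F'} → ℚ̄₃ˣ` is a RESIDUALLY TRIVIAL character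
(`‖θ σ − 1‖ < 1`).  The fields come WITHOUT an `Algebra K L` instance: the restriction from `Γ_L` to
`Γ_K` is the composite of the chosen restriction maps, `φ = res_K^{F'} ∘ res_{F'}^L : Γ_L → Γ_K`
("tower form"), and the residual representation is

  `τ = GL₃(φ₃) ∘ r̄_f^B ∘ res_K^{F'} ∘ res_{F'}^L`,  `φ₃ = zmodToPadicAlgClResidueField 3 : 𝔽₃ → ℤ̄₃/𝔪`,

under the standing hypothesis of the line that the heart KEEPS ITS IMAGE along `φ`
(`(r̄ ∘ φ)(Γ_L) = r̄(Γ_K)`).  This file proves the three clauses consumed by the stub: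

* § 1 the integral model `GL₃(y) ∘ 𝓕.ρ ∘ φ` of `ρ_y ∘ φ` in the identity frame and its reduction
  `GL₃(φ₃) ∘ r̄ ∘ φ` ON THE NOSE, for ANY continuous `φ : Γ_L → Γ_K` (the proofs of
  `isReductionOf_pointRep_restrictField`, …ThorneAdequacyResidual § 3, only use that `res_K^L` is a
  homomorphism: `y` is local, `residue_pointCodRestrict`, and `𝓕.ρ mod π = r̄`, `𝓕.residual`); when `φ`
  keeps the image of the heart the reduction is absolutely irreducible (`isAbsIrreducible_rbar_comp`,
  …ThornePointAbsIrrRestrict), hence a residual representation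
  (`IsReductionOf.isResidualRepOf_of_isIrreducible`).
* § 2 a character `θ` with `‖θ σ − 1‖ < 1` is residually trivial in the sense of
  `Literature/…/ResidualRepTwist`: `θ σ ∈ ℤ̄₃` (ultrametric inequality) with residue `1`
  (`residue_eq_one_of_norm_sub_one_lt_one`); so twisting by it does not change residual representations
  (`FramedGaloisRep.isResidualRepOf_twist_iff`).
* § 3 the registered statement: (a) `((ρ_y|F') ⊗ θ)|L = (ρ_y ∘ φ) ⊗ (θ ∘ res_{F'}^L)` on the nose
  (`FramedGaloisRep.restrictField_twist`, `rfl`), so `τ` is a residual representation of it (§ 1, § 2);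
  (b) `τ(Γ_{L(ζ₃)})` is adequate in the sense of Thorne's Def. 2.20: `ζ₃ ∈ K ⊆ L` (the composite algebra
  structure) so `Γ_{L(ζ₃)} = Γ_L` (`map_absGaloisGroupAdjoinRootsOfUnity_three_eq_range`), the image is
  `GL₃(φ₃)(r̄(Γ_K))`, extended-adequate (`rbarExtendedAdequate` + `isExtendedAdequate_baseChange`, for
  generic `f` with `disc f ∉ ℚ² ∪ −3ℚ²`), and `ℤ̄₃/𝔪` is algebraically closed
  (`Subgroup.isThorne2017Adequate_iff_isExtendedAdequate`); (c) irreducibility: `ρ_y ∘ φ` is absolutely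
  irreducible (`isAbsolutelyIrreducible_pointRep_comp`, Burnside form along `φ`), and a twist of an
  irreducible representation is irreducible (`FramedRep.toRepresentation_twist`,
  `Representation.isIrreducible_twist_iff`).

No definition, no named fact; continuity of `y` is not needed (only integrality).
-/

set_option linter.dupNamespace false -- `Summit.Langlands.Langlands.…` is the problem's namespace

namespace Summit.Langlands.Langlands.Cruxes.MuOrdinaryFamilyRT.ThorneMinimalLift

open scoped NumberField Polynomial Matrix Classical
open Field IsDedekindDomain Polynomial IsLocalRing
open Literature.NumberTheory.GaloisRepresentations Literature.NumberTheory.Automorphic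
open Summit.Langlands.Langlands.Cruxes.MuOrdinaryFamilyRT.CharZeroDominance

noncomputable section

variable {f : ℤ[X]} {ι : PadicAlgCl 3 ≃+* ℂ} {e : K →+* ℂ} {S₀ : Finset (HeightOneSpectrum (𝓞 K))}
  {ρC : FramedGaloisRep K (PadicAlgCl 3) 3}

/-! ## 1. The integral model of `ρ_y ∘ φ` in the identity frame and its reduction -/

/-- **The integral model in the identity frame along `φ`**: `GL₃(y') ∘ 𝓕.ρ ∘ φ` (`y'` the corestriction
of the integral point `y` to `ℤ̄₃`) is an integral model (`P = 1`) of `ρ_y ∘ φ` for every framing `ρy` of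
`pointRep 𝓕 y` and every continuous `φ : Γ_L → Γ_K`. -/
theorem isIntegralModelOf_pointRep_comp (𝓕 : OrdFamily f ι e S₀ ρC) (y : 𝓕.R →+* PadicAlgCl 3)
    (hy : ∀ r : 𝓕.R, ‖y r‖ ≤ 1) {L : Type*} [Field L]
    (φ : absoluteGaloisGroup L →ₜ* absoluteGaloisGroup K)
    (ρy : FramedGaloisRep K (PadicAlgCl 3) 3) (hρy : ∀ g, ρy g = pointRep 𝓕 y g) :
    IsIntegralModelOf (ρy.comp φ : absoluteGaloisGroup L →* GL (Fin 3) (PadicAlgCl 3))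
      ((Matrix.GeneralLinearGroup.map
          (y.codRestrict (padicAlgClIntegers 3) (point_mem_padicAlgClIntegers 𝓕 y hy))).comp
        (𝓕.ρ.comp φ.toMonoidHom)) := by
  -- adapted from `isIntegralModelOf_pointRep_restrictField` (…ThorneAdequacyResidual), `res_K^L ↝ φ`
  refine ⟨1, fun g => ?_⟩
  rw [inv_one, one_mul, mul_one]
  apply Units.ext
  change (((𝓕.ρ (φ g)).val.map
      (y.codRestrict (padicAlgClIntegers 3) (point_mem_padicAlgClIntegers 𝓕 y hy))).map
        (padicAlgClIntegers 3).subtype) = (ρy (φ g)).val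
  rw [hρy, Matrix.map_map]
  rfl

/-- **The reduction of the integral model along `φ` is `GL₃(φ₃) ∘ r̄ ∘ φ` on the nose**: entrywise
`y' ((𝓕.ρ (φ σ))ᵢⱼ) mod 𝔪 = φ₃ (π ((𝓕.ρ (φ σ))ᵢⱼ)) = φ₃ ((r̄ (φ σ))ᵢⱼ)` (`residue_pointCodRestrict`,
`𝓕.residual`). -/
theorem integralReduction_pointRep_comp (𝓕 : OrdFamily f ι e S₀ ρC) (y : 𝓕.R →+* PadicAlgCl 3)
    (hy : ∀ r : 𝓕.R, ‖y r‖ ≤ 1) {L : Type*} [Field L]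
    (φ : absoluteGaloisGroup L →ₜ* absoluteGaloisGroup K)
    (φ₃ : ZMod 3 →+* padicAlgClResidueField 3) (g : absoluteGaloisGroup L) :
    integralReduction (RingHom.id _)
        ((Matrix.GeneralLinearGroup.map
            (y.codRestrict (padicAlgClIntegers 3) (point_mem_padicAlgClIntegers 𝓕 y hy))).comp
          (𝓕.ρ.comp φ.toMonoidHom)) g =
      (Matrix.GeneralLinearGroup.map φ₃).comp ((rbar f 𝓕.B).comp φ.toMonoidHom) g := by
  -- adapted from `integralReduction_pointRep_restrictField` (…ThorneAdequacyResidual), `res_K^L ↝ φ`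
  apply Units.ext
  ext i j
  rw [integralReduction_apply_coe, RingHom.id_apply]
  change residue (padicAlgClIntegers 3)
      (y.codRestrict (padicAlgClIntegers 3) (point_mem_padicAlgClIntegers 𝓕 y hy)
        ((𝓕.ρ (φ g)).val i j)) =
    φ₃ ((rbar f 𝓕.B (φ g)).val i j)
  rw [residue_pointCodRestrict 𝓕 y hy φ₃, ← 𝓕.residual (φ g), Matrix.map_apply]
  rfl

/-- **`GL₃(φ₃) ∘ r̄ ∘ φ` is a reduction of `ρ_y ∘ φ`** (`IsReductionOf` along `RingHom.id (ℤ̄₃/𝔪)`,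
frames `P = Q = 1`), for every continuous `φ : Γ_L → Γ_K` and every integral point `y`. -/
theorem isReductionOf_pointRep_comp (𝓕 : OrdFamily f ι e S₀ ρC) (y : 𝓕.R →+* PadicAlgCl 3)
    (hy : ∀ r : 𝓕.R, ‖y r‖ ≤ 1) {L : Type*} [Field L]
    (φ : absoluteGaloisGroup L →ₜ* absoluteGaloisGroup K)
    (ρy : FramedGaloisRep K (PadicAlgCl 3) 3) (hρy : ∀ g, ρy g = pointRep 𝓕 y g)
    (φ₃ : ZMod 3 →+* padicAlgClResidueField 3) :
    FramedGaloisRep.IsReductionOf (ρy.comp φ) (RingHom.id _)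
      ((Matrix.GeneralLinearGroup.map φ₃).comp ((rbar f 𝓕.B).comp φ.toMonoidHom)) :=
  ⟨_, 1, isIntegralModelOf_pointRep_comp 𝓕 y hy φ ρy hρy, fun g => by
    rw [one_mul, inv_one, mul_one, integralReduction_pointRep_comp 𝓕 y hy φ φ₃ g]⟩

/-- **`GL₃(φ₃) ∘ r̄ ∘ φ` is a residual representation of `ρ_y ∘ φ`** whenever `φ` keeps the image of the
heart (`r̄(Γ_K) ≤ r̄(φ Γ_L)`): the reduction of § 1 is then absolutely irreducible
(`isAbsIrreducible_rbar_comp`), hence its own semisimplification. -/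
theorem isResidualRepOf_pointRep_comp (𝓕 : OrdFamily f ι e S₀ ρC) (hgen : Generic f)
    {L : Type*} [Field L] (φ : absoluteGaloisGroup L →ₜ* absoluteGaloisGroup K)
    (hφ : (rbar f 𝓕.B).range ≤ ((rbar f 𝓕.B).comp φ.toMonoidHom).range)
    (y : 𝓕.R →+* PadicAlgCl 3) (hy : ∀ r : 𝓕.R, ‖y r‖ ≤ 1)
    (ρy : FramedGaloisRep K (PadicAlgCl 3) 3) (hρy : ∀ g, ρy g = pointRep 𝓕 y g)
    (φ₃ : ZMod 3 →+* padicAlgClResidueField 3) :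
    FramedGaloisRep.IsResidualRepOf (ρy.comp φ) (RingHom.id _)
      ((Matrix.GeneralLinearGroup.map φ₃).comp ((rbar f 𝓕.B).comp φ.toMonoidHom)) :=
  (isReductionOf_pointRep_comp 𝓕 y hy φ ρy hρy φ₃).isResidualRepOf_of_isIrreducible
    (isAbsIrreducible_rbar_comp hgen 𝓕.B φ.toMonoidHom hφ _ φ₃)

/-! ## 2. Characters congruent to `1` are residually trivial -/

/-- **A `ℚ̄_ℓˣ`-valued character with `‖θ σ − 1‖ < 1` is residually trivial**: `θ σ` lies in `ℤ̄_ℓ`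
(ultrametric inequality, `‖θ σ‖ ≤ max ‖θ σ − 1‖ ‖1‖ ≤ 1`) and has residue `1`
(`residue_eq_one_of_norm_sub_one_lt_one`) — the hypothesis of `FramedGaloisRep.isResidualRepOf_twist_iff`. -/
theorem exists_padicAlgClIntegers_residue_eq_one_of_norm_sub_one_lt_one {ℓ : ℕ} [Fact ℓ.Prime]
    {G : Type*} [Group G] [TopologicalSpace G] (θ : G →ₜ* (PadicAlgCl ℓ)ˣ)
    (hθ : ∀ σ : G, ‖((θ σ : (PadicAlgCl ℓ)ˣ) : PadicAlgCl ℓ) - 1‖ < 1) (σ : G) :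
    ∃ u : padicAlgClIntegers ℓ, (u : PadicAlgCl ℓ) = ((θ σ : (PadicAlgCl ℓ)ˣ) : PadicAlgCl ℓ) ∧
      residue (padicAlgClIntegers ℓ) u = 1 := by
  have hle : ‖((θ σ : (PadicAlgCl ℓ)ˣ) : PadicAlgCl ℓ)‖ ≤ 1 := by
    have h := PadicAlgCl.isNonarchimedean ℓ (((θ σ : (PadicAlgCl ℓ)ˣ) : PadicAlgCl ℓ) - 1) 1
    rw [sub_add_cancel, norm_one] at h
    exact h.trans (max_le (hθ σ).le le_rfl)
  exact ⟨⟨_, (padicAlgCl_mem_valuationSubring_iff ℓ _).2 hle⟩, rfl,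
    residue_eq_one_of_norm_sub_one_lt_one (hθ σ)⟩

/-! ## 3. The registered glue H6' = G10' -/

/-- **H6' = G10' `residual_adequate_twist_pointRep_tower` (registered PA-I glue, PROVED).**  For generic `f`
with `disc f ∉ ℚ² ∪ −3ℚ²`, a family `𝓕`, number fields `F' ⊇ K` and `L ⊇ F'` such that the heart keeps its
image along the composite restriction `φ = res_K^{F'} ∘ res_{F'}^L` (`(r̄ ∘ φ)(Γ_L) = r̄(Γ_K)`), an integral
`ℚ̄₃`-point `y` of `𝓕.R`, a framing `ρy` of `pointRep 𝓕 y` and a character `θ : Γ_{F'} → ℚ̄₃ˣ` with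
`‖θ σ − 1‖ < 1`, the representation `ρ = ((ρy|Γ_{F'}) ⊗ θ)|Γ_L` and
`τ = GL₃(φ₃) ∘ r̄_f^B ∘ res_K^{F'} ∘ res_{F'}^L` (`φ₃ = zmodToPadicAlgClResidueField 3`) satisfy: `τ` is a
residual representation of `ρ` along `RingHom.id (ℤ̄₃/𝔪)`; `τ(Γ_{L(ζ₃)})` is adequate in the sense of
Thorne, Math. Z. 285 (2017), Def. 2.20; and `ρ` is irreducible — hypothesis (ii) and the irreducibility
input of `Thorne2017.automorphyLifting_unitary_ordinaryMinimal` for `F = L`, `p = 3`.  Proof: § 1–§ 2 of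
this file, § 1–§ 2 of …ThorneAdequacyResidual and § 2 of …ThornePointAbsIrrRestrict, as explained in the
module docstring. -/
theorem residual_adequate_twist_pointRep_tower : ∀ (f : ℤ[X]) (ι : PadicAlgCl 3 ≃+* ℂ) (e : K →+* ℂ) (S₀ : Finset (HeightOneSpectrum (𝓞 K))) (ρC : FramedGaloisRep K (PadicAlgCl 3) 3) (𝓕 : OrdFamily f ι e S₀ ρC), Generic f → ¬ IsSquare (f.map (Int.castRingHom ℚ)).discr → ¬ IsSquare ((-3 : ℚ) * (f.map (Int.castRingHom ℚ)).discr) → ∀ (F' : Type) [Field F'] [NumberField F'] [Algebra K F'] (L : Type) [Field L] [NumberField L] [Algebra F' L], (((rbar f 𝓕.B).comp (absGaloisRestrict K F').toMonoidHom).comp (absGaloisRestrict F' L).toMonoidHom).range = (rbar f 𝓕.B).range → ∀ (y : 𝓕.R →+* PadicAlgCl 3), (∀ r : 𝓕.R, ‖y r‖ ≤ 1) → ∀ (ρy : FramedGaloisRep K (PadicAlgCl 3) 3), (∀ g, ρy g = pointRep 𝓕 y g) → ∀ (θ : absoluteGaloisGroup F' →ₜ* (PadicAlgCl 3)ˣ),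 (∀ σ : absoluteGaloisGroup F', ‖((θ σ : (PadicAlgCl 3)ˣ) : PadicAlgCl 3) - 1‖ < 1) → (FramedGaloisRep.restrictField L ((ρy.restrictField F').twist θ)).IsResidualRepOf (RingHom.id _) ((Matrix.GeneralLinearGroup.map (zmodToPadicAlgClResidueField 3)).comp (((rbar f 𝓕.B).comp (absGaloisRestrict K F').toMonoidHom).comp (absGaloisRestrict F' L).toMonoidHom)) ∧ Subgroup.IsThorne2017Adequate ((absGaloisGroupAdjoinRootsOfUnity L 3).map ((Matrix.GeneralLinearGroup.map (zmodToPadicAlgClResidueField 3)).comp (((rbar f 𝓕.B).comp (absGaloisRestrict K F').toMonoidHom).comp (absGaloisRestrict F' L).toMonoidHom))) ∧ (FramedGaloisRep.restrictField L ((ρy.restrictField F').twist θ)).toGaloisRep.IsIrreducible := by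
  intro f ι e S₀ ρC 𝓕 hgen hD hD3 F' _ _ _ L _ _ _ hL y hy ρy hρy θ hθ
  -- the composite restriction `φ = res_K^{F'} ∘ res_{F'}^L` and the bookkeeping identities (all `rfl`)
  set φ : absoluteGaloisGroup L →ₜ* absoluteGaloisGroup K :=
    (absGaloisRestrict K F').comp (absGaloisRestrict F' L)
  have hφm :
      ((rbar f 𝓕.B).comp (absGaloisRestrict K F').toMonoidHom).comp (absGaloisRestrict F' L).toMonoidHom =
        (rbar f 𝓕.B).comp φ.toMonoidHom := rfl
  have hrep : FramedGaloisRep.restrictField L ((ρy.restrictField F').twist θ) =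
      FramedRep.twist (ρy.comp φ) (θ.comp (absGaloisRestrict F' L)) := rfl
  have hL' : ((rbar f 𝓕.B).comp φ.toMonoidHom).range = (rbar f 𝓕.B).range := by
    rw [← hφm]; exact hL
  have hkeep : (rbar f 𝓕.B).range ≤ ((rbar f 𝓕.B).comp φ.toMonoidHom).range :=
    (range_comp_eq_iff _ _).1 hL'
  -- `θ|Γ_L` is residually trivial
  have hχ := exists_padicAlgClIntegers_residue_eq_one_of_norm_sub_one_lt_one
    (θ.comp (absGaloisRestrict F' L)) fun σ => hθ (absGaloisRestrict F' L σ)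
  rw [hφm, hrep]
  refine ⟨?_, ?_, ?_⟩
  · -- (a) residual representation: untwist, then § 1
    exact (FramedGaloisRep.isResidualRepOf_twist_iff hχ).2
      (isResidualRepOf_pointRep_comp 𝓕 hgen φ hkeep y hy ρy hρy (zmodToPadicAlgClResidueField 3))
  · -- (b) adequacy of `τ(Γ_{L(ζ₃)}) = τ(Γ_L) = GL₃(φ₃)(r̄(Γ_K))`
    letI : Algebra K L := ((algebraMap F' L).comp (algebraMap K F')).toAlgebra
    haveI : IsAlgClosed (padicAlgClResidueField 3) :=
      Literature.RingTheory.Valuation.isAlgClosed_residueField (padicAlgClIntegers 3)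
    rw [map_absGaloisGroupAdjoinRootsOfUnity_three_eq_range L,
      Subgroup.isThorne2017Adequate_iff_isExtendedAdequate, MonoidHom.range_comp, hL']
    exact isExtendedAdequate_baseChange _ _ (rbarExtendedAdequate f 𝓕.B hgen hD hD3)
  · -- (c) irreducibility: `ρ_y ∘ φ` is absolutely irreducible, and twisting preserves irreducibility
    have habs : FramedRep.IsAbsolutelyIrreducible (ρy.comp φ) :=
      isAbsolutelyIrreducible_pointRep_comp 𝓕 hgen φ hkeep y hy ρy hρy
    change
      (FramedRep.twist (ρy.comp φ) (θ.comp (absGaloisRestrict F' L))).toRepresentation.IsIrreducible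
    rw [FramedRep.toRepresentation_twist]
    exact (Literature.RepresentationTheory.Semisimple.Representation.isIrreducible_twist_iff _ _).2
      habs.isIrreducible

end

end Summit.Langlands.Langlands.Cruxes.MuOrdinaryFamilyRT.ThorneMinimalLift
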